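import Summits.ResolutionOfSingularities.ResolutionOfSingularities.Theorems.EquisingularLiftEquisingularLiftNatNDInvariantsP
import Literature.AlgebraicGeometry.Resolution.BlowupDisjointCentreSplitting
import Literature.AlgebraicGeometry.Resolution.NormalCrossingsLocal
import Literature.AlgebraicGeometry.Resolution.PointBlowupHsFunMono
import Literature.AlgebraicGeometry.Resolution.AlterationsSingularComponents
import HarnessLib

/-!
# [OURS · L1 W4.5(b) · EL♮(3) · D4-0d] THE GENERIC-POINT LOCK: off the centre a blow-up does not change the reduced strict transform's local
# rings, so a singular curve not contained in the centre PERSISTS, and a stage with infinitely many non-regular points is never an ND-leaves end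

Cell `res-hironaka`, crux EL♮(3) `EquisingularLiftNatThree` (stmt-ResolutionOfSingularities-20148), chain W4.5b, line `sections`; desk DEAL D4-0d
(2026-08-28T18:44Z) to res-L1-w45b-iso-w1 g2 (second reader by type: res-L1-w45b-nose-w4).  OURS; NOT a statement of any manuscript; nothing of
[Hironaka2017] is asserted; AI-written kernel algebra, weaker than expert review.  Def-free, `sorry`-free, standard axioms.
`--kind proof --supports stmt-ResolutionOfSingularities-20148 --as helper`.

WHY.  Both residue censuses lean on it: the iso side (res-L1-w45b-iso-w1 `BETA1-FINDING.md` (N1): S10's post-carrier NEST schedules keep the singular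
curve φ̃_q / Γ̃_q / σ∗, desk R42) and the nose side (S_ν(4), WIDTH TABLE D4 «HOSTED NOSE» step (1)).  In the reach currency a step replaces the running
set `T` on `X` by `T′ = closure (π⁻¹(T ∖ W))` on the blow-up `π : X′ → X` along `𝓘(W)` (`IsBlowup π (vanishingIdeal ⟨W, hW⟩)`), and the ND-leaves
blob asks at the end for `ND.NDInvP`: the reduced closure `(closure T)~` has FINITELY many non-regular points.

CONTENTS (namespace `…Cruxes.EquisingularLiftNat.Sections`; the reduced closed subscheme on a closed `Z` is spelled `(vanishingIdeal ⟨Z, hZ⟩).subscheme` = the chain's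
`redSub X Z hZ` of `…NatDirZeroDefs`, definitionally — not imported here to stay outside the Theses cone):
* (L1′) `mem_strictTransform_iff_of_notMem` — for `π x′ ∉ W`: `x′ ∈ T′ ↔ π x′ ∈ closure T` (the blow-up is a homeomorphism over `X ∖ W`,
  ✓ `IsBlowup.isIso_morphismRestrict_compl_of_vanishingIdeal`).
* ★ (L1) `isRegularLocalRing_stalk_strictTransform_iff` — for `π z′ ∉ W` and `z` the point of `(closure T)~` under `z′` (the CLOSED-`T` instance up to
  `closure_closure` is res-L1-w45b-nose-w4's ✓ p655238 `centreLock_of_isBlowup` (`…NatNoseResidueCentreLock`) — one lock, two spellings):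
  `𝒪_{T̃′, z′}` is regular iff `𝒪_{T̃, z}` is.  Proof: `c := (π ∣_ Wᶜ) ≫ Wᶜ.ι : V = π⁻¹(Wᶜ) → X` is an OPEN IMMERSION with `V.ι⁻¹ T′ = c⁻¹ (closure T)`,
  so the two reduced ideal sheaves pull back to THE SAME ideal sheaf on `V` (✓ `comap_vanishingIdeal_of_isOpenImmersion`), whose stalk at the point is the
  image of either stalk ideal under the (invertible) stalk map (✓ `stalkIdeal_comap_of_isOpenImmersion`); conclude by ✓ `isRegularLocalRing_stalk_subscheme_iff`.
* (L2a) `not_isRegularLocalRing_stalk_of_specializes` — GENERISATION on a reduced closed subscheme `Z~`: if `z ⤳ z₀` in `X` and `𝒪_{Z~, z}` is NOT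
  regular then neither is `𝒪_{Z~, z₀}` (contrapositive of ✓ Literature `isRegularLocalRing_quotient_stalkIdeal_of_specializes`, Matsumura Thm. 19.3, PROVED there).
* (L2b) `infinite_setOf_not_isRegularLocalRing_strictTransform` — infinitely many non-regular points of `T̃` off `W` ⇒ infinitely many non-regular
  points of `T̃′` ((L1) + (L1′); `π` is injective over `X ∖ W`).
* ★ (L2c) `infinite_setOf_not_isRegularLocalRing_strictTransform_of_specializes` — THE CURVE LOCK: `T̃` non-regular at a point `η` whose closure
  `C = cl{η}` has `C ∖ W` infinite ⇒ `T̃′` has infinitely many non-regular points ((L2a) puts all of `C` in the non-regular locus, (L2b) transports `C ∖ W`).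
  The hypothesis is `(C ∖ W).Infinite` — NOT «`C` irreducible, `C ⊄ W`», which does not imply it in general (Spec of a DVR); for curves on stages of finite
  type over a field it is evident and is what the censuses use.
* (L3) `ND.not_ndInvP_of_infinite` — infinitely many non-regular points of `(closure T)~` ⇒ `¬ ND.NDInvP n k m F ρ T` for every `m`; and the headline
  ★ `ND.not_ndInvP_strictTransform_of_specializes` — under (L2c)'s hypotheses NO `m, ρ′` make `ND.NDInvP n k m X′ ρ′ T′` true.

HONEST SCOPE.  Pure scheme bookkeeping (any schemes, no Noetherian / finite-type hypothesis except where the cited lemmas need none); it does not decide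
which centres are LEGAL in the chains (that is the memo-level legality census of res-L1-w45b-lead-1 (H2)/(H3)) — it only certifies that a legal step whose
centre misses infinitely many singular points of a curve cannot produce an ND-leaves end.  Dim-3 char-p resolution is a theorem in print (Cossart–Piltant
2008/2009); EL♮(3) is NOT proved here; counted 0 toward the summit.
-/

set_option linter.dupNamespace false

noncomputable section

open CategoryTheory AlgebraicGeometry TopologicalSpace Topology IsLocalRing
open Literature.AlgebraicGeometry.Resolution
open AlgebraicGeometry.Scheme.IdealSheafData

namespace Summit.ResolutionOfSingularities.ResolutionOfSingularities.Cruxes.EquisingularLiftNat.Sections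

variable {X X' : Scheme.{0}} (π : X' ⟶ X) {W : Set X} (hW : IsClosed W)

/-! ## §1 Over the complement of the centre: the open immersion `c = (π ∣_ Wᶜ) ≫ Wᶜ.ι` and the strict transform -/

/-- Over `X ∖ W` the blow-up restricts to an isomorphism, so `(π ∣_ Wᶜ) ≫ (Wᶜ ↪ X)` is an open immersion. [OURS · bookkeeping] -/
theorem isOpenImmersion_morphismRestrict_compl_comp_ι (hπ : IsBlowup π (vanishingIdeal (⟨W, hW⟩ : Closeds X))) :
    IsOpenImmersion ((π ∣_ (⟨Wᶜ, hW.isOpen_compl⟩ : X.Opens)) ≫ Scheme.Opens.ι (⟨Wᶜ, hW.isOpen_compl⟩ : X.Opens)) := by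
  haveI : IsIso (π ∣_ (⟨Wᶜ, hW.isOpen_compl⟩ : X.Opens)) := hπ.isIso_morphismRestrict_compl_of_vanishingIdeal
  infer_instance

/-- **(L1′)** Off the centre, the strict transform `closure (π⁻¹(T ∖ W))` is the preimage of `closure T`: for `π x′ ∉ W`,
`x′ ∈ closure (π⁻¹(T ∖ W)) ↔ π x′ ∈ closure T`. [OURS · L1 W4.5b · D4-0d] -/
theorem mem_strictTransform_iff_of_notMem (hπ : IsBlowup π (vanishingIdeal (⟨W, hW⟩ : Closeds X))) (T : Set X) {x' : X'}
    (hx' : π x' ∉ W) : x' ∈ closure (π ⁻¹' (T \ W)) ↔ π x' ∈ closure T := by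
  constructor
  · intro h
    have hsub : closure (π ⁻¹' (T \ W)) ⊆ π ⁻¹' closure T :=
      closure_minimal (Set.preimage_mono fun y hy => subset_closure hy.1) (isClosed_closure.preimage π.continuous)
    exact hsub h
  · intro h
    -- work on the open `V = π⁻¹(Wᶜ)`, over which `π` is an open embedding into `X`
    set U : X.Opens := ⟨Wᶜ, hW.isOpen_compl⟩ with hU
    haveI := isOpenImmersion_morphismRestrict_compl_comp_ι π hW hπ
    set c : ↑(π ⁻¹ᵁ U) ⟶ X := (π ⁻¹ᵁ U).ι ≫ π with hc
    have hcι : c = (π ∣_ U) ≫ Scheme.Opens.ι U := (morphismRestrict_ι π U).symm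
    haveI : IsOpenImmersion c := by rw [hcι]; infer_instance
    have hx'U : x' ∈ π ⁻¹ᵁ U := hx'
    let y : ↑(π ⁻¹ᵁ U) := ⟨x', hx'U⟩
    have hy : (π ⁻¹ᵁ U).ι y = x' := rfl
    have hcy : c y = π x' := by rw [hc, Scheme.Hom.comp_apply, hy]
    -- `y ∈ c⁻¹(closure T) = closure (c⁻¹ T)` and `c⁻¹ T ⊆ ι⁻¹(π⁻¹(T ∖ W))`
    have hce : Topology.IsOpenEmbedding c := c.isOpenEmbedding
    have h1 : y ∈ c ⁻¹' closure T := by rw [Set.mem_preimage, hcy]; exact h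
    rw [hce.isOpenMap.preimage_closure_eq_closure_preimage hce.continuous] at h1
    have h2 : c ⁻¹' T ⊆ (π ⁻¹ᵁ U).ι ⁻¹' (π ⁻¹' (T \ W)) := by
      intro w hw
      refine ⟨?_, ?_⟩
      · show π ((π ⁻¹ᵁ U).ι w) ∈ T
        rw [← Scheme.Hom.comp_apply, ← hc]; exact hw
      · have : π ((π ⁻¹ᵁ U).ι w) ∈ U := w.2
        exact this
    have h3 : y ∈ closure ((π ⁻¹ᵁ U).ι ⁻¹' (π ⁻¹' (T \ W))) := closure_mono h2 h1
    have hιe : Topology.IsOpenEmbedding (π ⁻¹ᵁ U).ι := (π ⁻¹ᵁ U).ι.isOpenEmbedding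
    rw [← hιe.isOpenMap.preimage_closure_eq_closure_preimage hιe.continuous, Set.mem_preimage, hy] at h3
    exact h3

/-- **(L1) Off the centre, the local rings of the REDUCED strict transform are those of the reduced closure of `T`**: for a point `z′` of
`(closure (π⁻¹(T ∖ W)))~` with `π z′ ∉ W` and the point `z` of `(closure T)~` under it, `𝒪_{z′}` is a regular local ring iff `𝒪_z` is.
[OURS · L1 W4.5b · D4-0d] -/
theorem isRegularLocalRing_stalk_strictTransform_iff (hπ : IsBlowup π (vanishingIdeal (⟨W, hW⟩ : Closeds X))) (T : Set X)
    (z' : (vanishingIdeal (⟨closure (π ⁻¹' (T \ W)), isClosed_closure⟩ : Closeds X')).subscheme)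
    (hz' : π ((vanishingIdeal (⟨closure (π ⁻¹' (T \ W)), isClosed_closure⟩ : Closeds X')).subschemeι z') ∉ W)
    (z : (vanishingIdeal (⟨closure T, isClosed_closure⟩ : Closeds X)).subscheme)
    (hz : ((vanishingIdeal (⟨closure T, isClosed_closure⟩ : Closeds X)).subschemeι z : X) = π ((vanishingIdeal (⟨closure (π ⁻¹' (T \ W)), isClosed_closure⟩ : Closeds X')).subschemeι z')) :
    IsRegularLocalRing (((vanishingIdeal (⟨closure (π ⁻¹' (T \ W)), isClosed_closure⟩ : Closeds X')).subscheme).presheaf.stalk z') ↔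
      IsRegularLocalRing (((vanishingIdeal (⟨closure T, isClosed_closure⟩ : Closeds X)).subscheme).presheaf.stalk z) := by
  set x' : X' := (vanishingIdeal (⟨closure (π ⁻¹' (T \ W)), isClosed_closure⟩ : Closeds X')).subschemeι z' with hx'
  set U : X.Opens := ⟨Wᶜ, hW.isOpen_compl⟩ with hU
  haveI := isOpenImmersion_morphismRestrict_compl_comp_ι π hW hπ
  set c : ↑(π ⁻¹ᵁ U) ⟶ X := (π ⁻¹ᵁ U).ι ≫ π with hc
  have hcι : c = (π ∣_ U) ≫ Scheme.Opens.ι U := (morphismRestrict_ι π U).symm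
  haveI : IsOpenImmersion c := by rw [hcι]; infer_instance
  have hx'U : x' ∈ π ⁻¹ᵁ U := hz'
  let y : ↑(π ⁻¹ᵁ U) := ⟨x', hx'U⟩
  have hy : (π ⁻¹ᵁ U).ι y = x' := rfl
  have hcy : c y = π x' := by rw [hc, Scheme.Hom.comp_apply, hy]
  -- the two reduced ideal sheaves agree on `V = π⁻¹(Wᶜ)`
  set Z' : Closeds X' := ⟨closure (π ⁻¹' (T \ W)), isClosed_closure⟩ with hZ'
  set Z : Closeds X := ⟨closure T, isClosed_closure⟩ with hZ
  have hpre : Z'.preimage (π ⁻¹ᵁ U).ι.continuous = Z.preimage c.continuous := by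
    apply TopologicalSpace.Closeds.ext
    simp only [Closeds.coe_preimage, hZ', hZ, Closeds.coe_mk]
    ext w
    rw [Set.mem_preimage, Set.mem_preimage, hc, Scheme.Hom.comp_apply]
    exact mem_strictTransform_iff_of_notMem π hW hπ T w.2
  have hcomap : (vanishingIdeal Z').comap (π ⁻¹ᵁ U).ι = (vanishingIdeal Z).comap c := by
    rw [comap_vanishingIdeal_of_isOpenImmersion, comap_vanishingIdeal_of_isOpenImmersion, hpre]
  have hst : (stalkIdeal (vanishingIdeal Z') ((π ⁻¹ᵁ U).ι y)).map ((π ⁻¹ᵁ U).ι.stalkMap y).hom =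
      (stalkIdeal (vanishingIdeal Z) (c y)).map (c.stalkMap y).hom := by
    rw [← stalkIdeal_comap_of_isOpenImmersion, hcomap, stalkIdeal_comap_of_isOpenImmersion]
  -- transport the quotient stalks along the two stalk isomorphisms
  let e₁ : X'.presheaf.stalk ((π ⁻¹ᵁ U).ι y) ≃+* (↑(π ⁻¹ᵁ U) : Scheme.{0}).presheaf.stalk y :=
    (asIso ((π ⁻¹ᵁ U).ι.stalkMap y)).commRingCatIsoToRingEquiv
  let e₂ : X.presheaf.stalk (c y) ≃+* (↑(π ⁻¹ᵁ U) : Scheme.{0}).presheaf.stalk y := (asIso (c.stalkMap y)).commRingCatIsoToRingEquiv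
  let q₁ := Ideal.quotientEquiv (stalkIdeal (vanishingIdeal Z') ((π ⁻¹ᵁ U).ι y)) _ e₁ rfl
  let q₂ := Ideal.quotientEquiv (stalkIdeal (vanishingIdeal Z) (c y)) _ e₂ rfl
  have hq : X'.presheaf.stalk ((π ⁻¹ᵁ U).ι y) ⧸ stalkIdeal (vanishingIdeal Z') ((π ⁻¹ᵁ U).ι y) ≃+*
      X.presheaf.stalk (c y) ⧸ stalkIdeal (vanishingIdeal Z) (c y) :=
    (q₁.trans (Ideal.quotEquivOfEq (by
      change Ideal.map ((π ⁻¹ᵁ U).ι.stalkMap y).hom _ = Ideal.map (c.stalkMap y).hom _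
      exact hst))).trans q₂.symm
  rw [isRegularLocalRing_stalk_subscheme_iff, isRegularLocalRing_stalk_subscheme_iff, ← hx', hz, ← hcy, ← hy]
  exact ⟨fun h => IsRegularLocalRing.of_ringEquiv hq, fun h => IsRegularLocalRing.of_ringEquiv hq.symm⟩

/-! ## §2 Generisation and the persistence of infinitely many non-regular points -/

/-- **(L2a) Non-regularity of a reduced closed subscheme SPECIALISES** (= regularity generises, Matsumura Thm. 19.3 via ✓
`isRegularLocalRing_quotient_stalkIdeal_of_specializes`): for points `z ⤳ z₀` of `Z~`, if `𝒪_{Z~,z}` is not regular then `𝒪_{Z~,z₀}` is not regular.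
In particular a reduced closed subscheme singular at the generic point of a curve is singular at every point of the curve. [OURS · L1 W4.5b · D4-0d] -/
theorem not_isRegularLocalRing_stalk_of_specializes {Y : Scheme.{0}} (Z : Closeds Y) (z z₀ : (vanishingIdeal Z).subscheme)
    (h : ((vanishingIdeal Z).subschemeι z : Y) ⤳ (vanishingIdeal Z).subschemeι z₀)
    (hz : ¬ IsRegularLocalRing ((vanishingIdeal Z).subscheme.presheaf.stalk z)) :
    ¬ IsRegularLocalRing ((vanishingIdeal Z).subscheme.presheaf.stalk z₀) := by
  intro h₀
  apply hz
  rw [isRegularLocalRing_stalk_subscheme_iff] at h₀ ⊢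
  refine isRegularLocalRing_quotient_stalkIdeal_of_specializes (vanishingIdeal Z) h ?_ h₀
  have hr := Scheme.IdealSheafData.range_subschemeι (vanishingIdeal Z)
  change ((vanishingIdeal Z).subschemeι z : Y) ∈ ((vanishingIdeal Z).support : Set Y)
  rw [← hr]
  exact Set.mem_range_self z

/-- **(L2b)** If `(closure T)~` has infinitely many non-regular points lying off `W`, then the reduced strict transform `(closure (π⁻¹(T ∖ W)))~` has
infinitely many non-regular points ((L1′): over each such point there is a point of the strict transform; (L1): it is non-regular; `π` is injective
over `X ∖ W`). [OURS · L1 W4.5b · D4-0d] -/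
theorem infinite_setOf_not_isRegularLocalRing_strictTransform (hπ : IsBlowup π (vanishingIdeal (⟨W, hW⟩ : Closeds X))) (T : Set X)
    (hinf : Set.Infinite {x : X | x ∉ W ∧ ∃ z : (vanishingIdeal (⟨closure T, isClosed_closure⟩ : Closeds X)).subscheme,
      ((vanishingIdeal (⟨closure T, isClosed_closure⟩ : Closeds X)).subschemeι z : X) = x ∧ ¬ IsRegularLocalRing (((vanishingIdeal (⟨closure T, isClosed_closure⟩ : Closeds X)).subscheme).presheaf.stalk z)}) :
    Set.Infinite {z' : (vanishingIdeal (⟨closure (π ⁻¹' (T \ W)), isClosed_closure⟩ : Closeds X')).subscheme |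
      ¬ IsRegularLocalRing (((vanishingIdeal (⟨closure (π ⁻¹' (T \ W)), isClosed_closure⟩ : Closeds X')).subscheme).presheaf.stalk z')} := by
  set U : X.Opens := ⟨Wᶜ, hW.isOpen_compl⟩ with hU
  haveI hiso : IsIso (π ∣_ U) := hπ.isIso_morphismRestrict_compl_of_vanishingIdeal
  set I' := vanishingIdeal (⟨closure (π ⁻¹' (T \ W)), isClosed_closure⟩ : Closeds X') with hI'
  have hrange' : Set.range ((vanishingIdeal (⟨closure (π ⁻¹' (T \ W)), isClosed_closure⟩ : Closeds X')).subschemeι : _ → X') = closure (π ⁻¹' (T \ W)) := by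
    have := Scheme.IdealSheafData.range_subschemeι I'
    rwa [hI', Scheme.IdealSheafData.coe_support_vanishingIdeal] at this
  -- the map `x ↦ (the point of T̃′ over x)` on the given infinite set, and its injectivity through `π ∘ ι`
  set A := {x : X | x ∉ W ∧ ∃ z : (vanishingIdeal (⟨closure T, isClosed_closure⟩ : Closeds X)).subscheme,
      ((vanishingIdeal (⟨closure T, isClosed_closure⟩ : Closeds X)).subschemeι z : X) = x ∧ ¬ IsRegularLocalRing (((vanishingIdeal (⟨closure T, isClosed_closure⟩ : Closeds X)).subscheme).presheaf.stalk z)} with hA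
  set B := {z' : (vanishingIdeal (⟨closure (π ⁻¹' (T \ W)), isClosed_closure⟩ : Closeds X')).subscheme |
      ¬ IsRegularLocalRing (((vanishingIdeal (⟨closure (π ⁻¹' (T \ W)), isClosed_closure⟩ : Closeds X')).subscheme).presheaf.stalk z')} with hB
  -- every `x ∈ A` is `π (ι z′)` for some `z′ ∈ B`
  have hsurj : ∀ x ∈ A, ∃ z' ∈ B, π ((vanishingIdeal (⟨closure (π ⁻¹' (T \ W)), isClosed_closure⟩ : Closeds X')).subschemeι z') = x := by
    rintro x ⟨hxW, z, hzx, hzreg⟩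
    -- the point of `X′` over `x`
    obtain ⟨w, hw⟩ := (π ∣_ U).homeomorph.surjective ⟨x, hxW⟩
    have hπw : π w.1 = x := by
      have := congrArg Subtype.val hw
      rwa [Scheme.Hom.homeomorph_apply, morphismRestrict_base_coe] at this
    have hwT : w.1 ∈ closure (π ⁻¹' (T \ W)) := by
      rw [mem_strictTransform_iff_of_notMem π hW hπ T (by rw [hπw]; exact hxW), hπw, ← hzx]
      have hr := Scheme.IdealSheafData.range_subschemeι (vanishingIdeal (⟨closure T, isClosed_closure⟩ : Closeds X))
      rw [Scheme.IdealSheafData.coe_support_vanishingIdeal] at hr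
      have hmem := Set.mem_range_self (f := ((vanishingIdeal (⟨closure T, isClosed_closure⟩ : Closeds X)).subschemeι : _ → X)) z
      rw [hr] at hmem
      exact hmem
    rw [← hrange'] at hwT
    obtain ⟨z', hz'⟩ := hwT
    refine ⟨z', ?_, by rw [hz', hπw]⟩
    have hz'W : π ((vanishingIdeal (⟨closure (π ⁻¹' (T \ W)), isClosed_closure⟩ : Closeds X')).subschemeι z') ∉ W := by rw [hz', hπw]; exact hxW
    rw [hB, Set.mem_setOf_eq, isRegularLocalRing_stalk_strictTransform_iff π hW hπ T z' hz'W z (by rw [hzx, hz', hπw])]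
    exact hzreg
  intro hfin
  apply hinf
  refine (hfin.image fun z' => π ((vanishingIdeal (⟨closure (π ⁻¹' (T \ W)), isClosed_closure⟩ : Closeds X')).subschemeι z')).subset ?_
  intro x hx
  obtain ⟨z', hz'B, hz'x⟩ := hsurj x hx
  exact ⟨z', hz'B, hz'x⟩

/-- **(L2c) THE CURVE LOCK** — if the reduced closure of `T` is NOT regular at a point `η` and the closure `C = cl{η}` has infinitely many points off
the centre `W`, then the reduced strict transform `(closure (π⁻¹(T ∖ W)))~` has infinitely many non-regular points: by (L2a) every point of `C` is a
non-regular point of `T̃`, by (L2b) those off `W` persist.  (Typical use: `η` the generic point of a singular CURVE of the running strict transform not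
contained in the next centre.) [OURS · L1 W4.5b · D4-0d] -/
theorem infinite_setOf_not_isRegularLocalRing_strictTransform_of_specializes (hπ : IsBlowup π (vanishingIdeal (⟨W, hW⟩ : Closeds X)))
    (T : Set X) (η : (vanishingIdeal (⟨closure T, isClosed_closure⟩ : Closeds X)).subscheme)
    (hη : ¬ IsRegularLocalRing (((vanishingIdeal (⟨closure T, isClosed_closure⟩ : Closeds X)).subscheme).presheaf.stalk η))
    (hinf : (closure {((vanishingIdeal (⟨closure T, isClosed_closure⟩ : Closeds X)).subschemeι η : X)} \ W).Infinite) :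
    Set.Infinite {z' : (vanishingIdeal (⟨closure (π ⁻¹' (T \ W)), isClosed_closure⟩ : Closeds X')).subscheme |
      ¬ IsRegularLocalRing (((vanishingIdeal (⟨closure (π ⁻¹' (T \ W)), isClosed_closure⟩ : Closeds X')).subscheme).presheaf.stalk z')} := by
  refine infinite_setOf_not_isRegularLocalRing_strictTransform π hW hπ T (hinf.mono ?_)
  rintro x ⟨hxC, hxW⟩
  refine ⟨hxW, ?_⟩
  -- `x ∈ cl{η} ⊆ closure T` is a point of `T̃`, and `η ⤳ x`
  have hrange : Set.range ((vanishingIdeal (⟨closure T, isClosed_closure⟩ : Closeds X)).subschemeι : _ → X) = closure T := by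
    have := Scheme.IdealSheafData.range_subschemeι (vanishingIdeal (⟨closure T, isClosed_closure⟩ : Closeds X))
    rwa [Scheme.IdealSheafData.coe_support_vanishingIdeal] at this
  have hηT : ((vanishingIdeal (⟨closure T, isClosed_closure⟩ : Closeds X)).subschemeι η : X) ∈ closure T := by
    have hmem := Set.mem_range_self (f := ((vanishingIdeal (⟨closure T, isClosed_closure⟩ : Closeds X)).subschemeι : _ → X)) η
    rwa [hrange] at hmem
  have hxT : x ∈ closure T := (closure_minimal (Set.singleton_subset_iff.mpr hηT) isClosed_closure) hxC
  rw [← hrange] at hxT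
  obtain ⟨z, hz⟩ := hxT
  refine ⟨z, hz, ?_⟩
  refine not_isRegularLocalRing_stalk_of_specializes _ η z ?_ hη
  rw [specializes_iff_mem_closure, hz]
  exact hxC

/-- Transport of «infinitely many non-regular points» along an equality of the underlying closed sets. [OURS · bookkeeping] -/
theorem infinite_setOf_not_isRegularLocalRing_congr {Y : Scheme.{0}} {Z₁ Z₂ : Set Y} (h : Z₁ = Z₂) (h₁ : IsClosed Z₁) (h₂ : IsClosed Z₂)
    (hinf : Set.Infinite {z : (vanishingIdeal (⟨Z₁, h₁⟩ : Closeds Y)).subscheme | ¬ IsRegularLocalRing (((vanishingIdeal (⟨Z₁, h₁⟩ : Closeds Y)).subscheme).presheaf.stalk z)}) :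
    Set.Infinite {z : (vanishingIdeal (⟨Z₂, h₂⟩ : Closeds Y)).subscheme | ¬ IsRegularLocalRing (((vanishingIdeal (⟨Z₂, h₂⟩ : Closeds Y)).subscheme).presheaf.stalk z)} := by
  subst h
  exact hinf

/-! ## §3 The ND-leaves invariant fails at a stage with infinitely many non-regular points -/

namespace ND

/-- **(L3)** If the reduced closure of `T` has infinitely many non-regular points, `ND.NDInvP n k m F ρ T` fails for every `m` (its clause 2 puts the
non-regular points inside a finite set `S`). [OURS · L1 W4.5b · D4-0d] -/
theorem not_ndInvP_of_infinite (n : ℕ) (k : Type) [Field k] (m : ℕ) (F : Scheme.{0})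
    (ρ : F ⟶ (Literature.AlgebraicGeometry.Motives.projectiveSpace n k).left) (T : Set F)
    (h : Set.Infinite {z : (vanishingIdeal (⟨closure T, isClosed_closure⟩ : Closeds F)).subscheme | ¬ IsRegularLocalRing (((vanishingIdeal (⟨closure T, isClosed_closure⟩ : Closeds F)).subscheme).presheaf.stalk z)}) :
    ¬ NDInvP n k m F ρ T := by
  rintro ⟨S, -, hS, -⟩
  apply h
  refine ((S.finite_toSet.preimage_embedding ?_)).subset ?_
  · exact ⟨fun z => ((vanishingIdeal (⟨closure T, isClosed_closure⟩ : Closeds F)).subschemeι z : F), ((vanishingIdeal (⟨closure T, isClosed_closure⟩ : Closeds F)).subschemeι).isClosedEmbedding.injective⟩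
  · intro z hz
    simp only [Set.mem_preimage, Function.Embedding.coeFn_mk, Finset.mem_coe]
    by_contra hzS
    exact hz ((hS z).mpr hzS)

/-- ★ **THE GENERIC-POINT LOCK FOR THE ND-LEAVES BLOB** — if the reduced closure of the running set `T` is singular at a point `η` whose closure has
infinitely many points off the centre `W` of the next blow-up `π`, then at the new stage `(X′, T′ = closure (π⁻¹(T ∖ W)))` the invariant `ND.NDInvP`
fails for EVERY measure `m` and every structure map `ρ′`: the singular curve persists.  [OURS · L1 W4.5b · D4-0d] -/
theorem not_ndInvP_strictTransform_of_specializes (hπ : IsBlowup π (vanishingIdeal (⟨W, hW⟩ : Closeds X))) (T : Set X)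
    (η : (vanishingIdeal (⟨closure T, isClosed_closure⟩ : Closeds X)).subscheme) (hη : ¬ IsRegularLocalRing (((vanishingIdeal (⟨closure T, isClosed_closure⟩ : Closeds X)).subscheme).presheaf.stalk η))
    (hinf : (closure {((vanishingIdeal (⟨closure T, isClosed_closure⟩ : Closeds X)).subschemeι η : X)} \ W).Infinite)
    (n : ℕ) (k : Type) [Field k] (m : ℕ) (ρ' : X' ⟶ (Literature.AlgebraicGeometry.Motives.projectiveSpace n k).left) :
    ¬ NDInvP n k m X' ρ' (closure (π ⁻¹' (T \ W))) := by
  apply not_ndInvP_of_infinite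
  exact infinite_setOf_not_isRegularLocalRing_congr closure_closure.symm isClosed_closure isClosed_closure
    (infinite_setOf_not_isRegularLocalRing_strictTransform_of_specializes π hW hπ T η hη hinf)

end ND

end Summit.ResolutionOfSingularities.ResolutionOfSingularities.Cruxes.EquisingularLiftNat.Sections

end
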